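import Summits.Ventures.PercRepro.S2FourteenSixSpread
import Summits.Ventures.PercRepro.S2TriangleDegree
import Summits.Ventures.PercRepro.S2ThreeSetCounts

/-!
# PercRepro — S2: THE SPREAD CASE OF THE CELL `(13, 6)` COLOOP-FREE AT `≥ 9` TRIANGLES — BY THREE PAIRWISE DISJOINT TRIANGLES
(p7, gen 15; sub-claim S2; the first rows of the row `p = 13`)

On an `e`-free, coloop-free core of rank `13` on `19` points in the spread regime (no nullity-`4` set on `≤ 9` points) with
`t ≥ 9` triangles, `S2.exists_three_pairwise_disjoint_triangles_of_nine` gives three pairwise disjoint triangles `T₁ T₂ T₃`;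
then every top `6`-set is a cobasis and meets all three (`H₆(3) = C(19,6) − 3·C(16,6) + 3·C(13,6) − C(10,6) = 8046`,
`S2.ncard_subsets_inter_nonempty_three_add_le`) and every top `5`-set meets every pair of circuits, hence misses at most one
of the three (`H₅(3) = C(19,5) − 3·C(13,5) + 2·C(10,5) = 8271`, `S2.ncard_subsets_two_of_three_add_le`): the top count is
`≤ 16317`. With the tail of the kit at the exact `t` (`ncard_eRk_le_five_le_spread`, caps `35 / 158`) and the spanning count
`28781` (the three-triangles' Bonferroni), the cell inequality `1024·U ≤ (1024 − m)·2·9480`, `1024·(A + S) ≤ m·2^19` closes at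
`m = 141` (`t = 9`) and `m = 142` (`t = 10`; `t ≤ 10` is the triangle cap `cq3(6)`): `Φ(13, 5) = 1742/63 ≤ 2^18 / 9480`.
**`c025_thirteen_six_cf_spread_ge_nine`**; the same proof closes `t = 7, 8` whenever three pairwise disjoint triangles exist
(`m = 129 … 139`): **`c025_thirteen_six_cf_spread_of_three_disjoint'`** (`t ≥ 3`). The rows `t ≤ 8` without three disjoint triangles, the concentrated cases and the coloop cases of
`(13, 6)` are NOT here: nothing about the cell `(13, 6)` or the window is claimed. Axioms: standard.
-/

open scoped Matroid

namespace PercRepro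

namespace ThmN

open Set

variable {α : Type}

/-- `Φ(13, 5) = 1742 / 63` exactly. -/
theorem phiK_thirteen_five : phiK 13 5 = 1742 / 63 := by
  unfold phiK
  rw [show Finset.Ioo 5 13 = Finset.Icc 6 12 from rfl]
  simp only [Finset.sum_Icc_succ_top (show 6 ≤ 12 by norm_num), Finset.sum_Icc_succ_top (show 6 ≤ 11 by norm_num),
    Finset.sum_Icc_succ_top (show 6 ≤ 10 by norm_num), Finset.sum_Icc_succ_top (show 6 ≤ 9 by norm_num),
    Finset.sum_Icc_succ_top (show 6 ≤ 8 by norm_num), Finset.sum_Icc_succ_top (show 6 ≤ 7 by norm_num),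
    Finset.Icc_self, Finset.sum_singleton]
  norm_num [Nat.choose]

/-- **The caps of the coloop-free cell `(13, 6)`**: `s₃ ≤ 10`, `s₄ ≤ 35`, `s₅ ≤ 158` (the chains of `caps_fourteen_six_scaled_cf`
at `19` points). -/
theorem caps_thirteen_six_cf (M : Matroid α) [M.Finite]
    (hd : M.E.encard = M.eRank + ((6 : ℕ) : ℕ∞)) (hn : M.E.ncard = 13 + 6)
    (hfree : ∀ e ∈ M.E, ∃ A ⊆ M.E \ {e}, e ∉ M.closure A ∧ e ∉ M.closure ((M.E \ {e}) \ A)) (hK : ∀ e, ¬ M.IsColoop e) :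
    {C : Set α | M.IsCircuit C ∧ C.ncard = 3}.ncard ≤ 10 ∧
      {C : Set α | M.IsCircuit C ∧ C.ncard = 4}.ncard ≤ 35 ∧
        {C : Set α | M.IsCircuit C ∧ C.ncard = 5}.ncard ≤ 158 := by
  have hs3 := TriangleCap.core_ncard_triangles_le_cq3 M hfree hd
  rw [show TriangleCap.cq3 6 = 10 by decide] at hs3
  have hcol : M.coloops = ∅ := S2.coloops_eq_empty_of_forall_not M hK
  have hm : 19 ≤ (M.E \ M.coloops).ncard := by
    rw [hcol, Set.sdiff_empty, hn]
  have hd' : M.E.encard = M.eRank + (((5 : ℕ) : ℕ∞) + 1) := by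
    rw [hd]; norm_num
  have h := S1.ncard_fourCircuits_sub_div_le_of_nonColoops M hfree hd' (by norm_num) hm (B := 28)
    (fun M' _ hfree' hd'' => by
      have h := ncard_fourCircuits_le_avgChain16 5 M' hfree' hd''
      rw [show avgChain16 5 = 28 by decide] at h
      exact h)
  have hs4 : {C : Set α | M.IsCircuit C ∧ C.ncard = 4}.ncard ≤ 35 := by
    have := S1.le_mul_div_of_sub_div_le (by norm_num : 4 < 19) h
    omega
  have hs5 := S2.ncard_fiveCircuits_le_of_no_coloop M hfree hd' hK (by omega)
  rw [hn] at hs5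
  have h5 : (13 + 6) * S1.avgChain5b 5 / (13 + 6 - 5) = 158 := by
    rw [show S1.avgChain5b 5 = 117 by decide]
  rw [h5] at hs5
  exact ⟨hs3, hs4, hs5⟩

/-- A set meeting each of the three pairwise unions `Y₁ ∪ Y₂`, `Y₁ ∪ Y₃`, `Y₂ ∪ Y₃` meets at least two of `Y₁ Y₂ Y₃`. -/
theorem two_of_three_of_pair_unions {B Y₁ Y₂ Y₃ : Set α}
    (h12 : (B ∩ (Y₁ ∪ Y₂)).Nonempty) (h13 : (B ∩ (Y₁ ∪ Y₃)).Nonempty) (h23 : (B ∩ (Y₂ ∪ Y₃)).Nonempty) :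
    ((B ∩ Y₁).Nonempty ∧ (B ∩ Y₂).Nonempty) ∨ ((B ∩ Y₁).Nonempty ∧ (B ∩ Y₃).Nonempty) ∨
      ((B ∩ Y₂).Nonempty ∧ (B ∩ Y₃).Nonempty) := by
  rw [Set.inter_union_distrib_left, Set.union_nonempty] at h12 h13 h23
  tauto

/-- **The spread case of the coloop-free cell `(13, 6)` at `≥ 3` triangles, given three pairwise disjoint triangles**
(`m = 129 / 131 / 133 / 135 / 137 / 139 / 141 / 142` at `t = 3 … 10`). -/
theorem c025_thirteen_six_cf_spread_of_three_disjoint' (M : Matroid α) [M.Finite]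
    (hR : M.eRank = ((13 : ℕ) : ℕ∞)) (hn : M.E.ncard = 13 + 6)
    (hfree : ∀ e ∈ M.E, ∃ A ⊆ M.E \ {e}, e ∉ M.closure A ∧ e ∉ M.closure ((M.E \ {e}) \ A)) (hK : ∀ e, ¬ M.IsColoop e)
    (h4 : ¬ ∃ W ⊆ M.E, W.ncard ≤ 9 ∧ W.encard = M.eRk W + 4)
    (ht3 : 3 ≤ {C : Set α | M.IsCircuit C ∧ C.ncard = 3}.ncard)
    {T₁ T₂ T₃ : Set α} (hT₁ : M.IsCircuit T₁) (hT₁3 : T₁.ncard = 3) (hT₂ : M.IsCircuit T₂) (hT₂3 : T₂.ncard = 3)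
    (hT₃ : M.IsCircuit T₃) (hT₃3 : T₃.ncard = 3) (d12 : Disjoint T₁ T₂) (d13 : Disjoint T₁ T₃) (d23 : Disjoint T₂ T₃) :
    RLS M 13 5 := by
  classical
  have hd : M.E.encard = M.eRank + ((6 : ℕ) : ℕ∞) := by
    rw [hR, ← M.ground_finite.cast_ncard_eq, hn]
    push_cast
    ring
  obtain ⟨hs3, hs4, hs5⟩ := caps_thirteen_six_cf M hd hn hfree hK
  have hflat : ∀ X ⊆ M.E, M.eRk X ≤ 5 → X.ncard ≤ 8 := fun X hX hr => by
    have := S2.ncard_le_of_eRk_le_of_not_nullity M 4 9 (by norm_num) h4 hX (r := 5) (by norm_num) (by exact_mod_cast hr)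
    omega
  have hflat' : ∀ X ⊆ M.E, M.eRk X ≤ 4 → X.ncard ≤ 7 := fun X hX hr => by
    have := S2.ncard_le_of_eRk_le_of_not_nullity M 4 9 (by norm_num) h4 hX (r := 4) (by norm_num) (by exact_mod_cast hr)
    omega
  have hs : ∀ e ∈ M.E, ∀ f ∈ M.E, e ≠ f → M.eRk {e, f} = 2 := by
    intro e he f hf hef
    have h2 : (2 : ℕ∞) ≤ M.eRk {e, f} :=
      two_le_eRk_of_two_le_ncard_of_free M hfree (pair_subset he hf) (by rw [ncard_pair hef])
    have h3 : M.eRk {e, f} ≤ 2 := by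
      have := M.eRk_le_encard {e, f}
      rwa [encard_pair hef] at this
    exact le_antisymm h3 h2
  have hC1 : ∀ L ⊆ M.E, M.eRk L = 2 → L.ncard ≤ 3 :=
    fun L hL hr => ncard_le_three_of_eRk_two M hs hfree hL hr
  have hTfin : {C : Set α | M.IsCircuit C ∧ C.ncard = 3}.Finite :=
    M.ground_finite.finite_subsets.subset (fun C hC => hC.1.subset_ground)
  have h9 : ∀ X ⊆ M.E, X.ncard ≤ 9 → X.encard ≤ M.eRk X + 3 := by
    intro X hX hX9
    by_contra hlt
    push Not at hlt
    have hk : M.eRk X + 4 ≤ X.encard := by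
      have := Order.add_one_le_of_lt hlt
      rwa [add_assoc, show (3 : ℕ∞) + 1 = 4 by norm_num] at this
    obtain ⟨W', hW'X, hW'⟩ := S2.exists_subset_encard_eq_eRk_add M hX 4 hk
    exact h4 ⟨W', hW'X.trans hX, (Set.ncard_le_ncard hW'X (M.ground_finite.subset hX)).trans hX9, hW'⟩
  -- the cell inequality with `K = 9480`, `Φ(13, 5) = 1742 / 63 ≤ 2^18 / 9480`
  have cellA : ∀ (U S m : ℕ) (A : ℚ), Matroid.topCount M 13 5 ≤ U →
      {X : Set α | X ⊆ M.E ∧ M.eRk X = M.eRank}.ncard ≤ S → m ≤ 1024 →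
      1024 * (U : ℚ) ≤ ((1024 - m : ℕ) : ℚ) * 2 ^ (6 - 5) * (9480 : ℚ) →
      (1024 : ℚ) * (A + (S : ℚ)) ≤ (m : ℚ) * 2 ^ 19 →
      ({X : Set α | X ⊆ M.E ∧ M.eRk X ≤ 5}.ncard : ℚ) ≤ A → RLS M 13 5 := by
    intro U S m A hU hS hm hpoly htail hA
    rw [RLS_iff]
    exact c025_core_five_cell_of_counts_xqictq5g M 13 6 (by norm_num) hR hn U hU _ hA S hS
      9480 (by norm_num) (phiK 13 5) (by rw [phiK_thirteen_five]; norm_num) ⟨m, hm, hpoly, htail⟩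
  -- the top count is the top `5`-sets plus the top `6`-sets
  have hU1 := S2.topCount_le_ncard_compl_spanning (M := M) hR hd 5
  simp only [Nat.cast_ofNat] at hU1
  have hsplit : {B : Set α | B ⊆ M.E ∧ M.eRk B = 5 ∧ B.ncard ≤ 6 ∧ M.eRk (M.E \ B) = M.eRank}.ncard ≤
      {B : Set α | B ⊆ M.E ∧ B.ncard = 5 ∧ M.eRk B = 5 ∧ M.eRk (M.E \ B) = M.eRank}.ncard +
      {B : Set α | B ⊆ M.E ∧ B.ncard = 6 ∧ M.eRk B = 5 ∧ M.eRk (M.E \ B) = M.eRank}.ncard := by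
    refine le_trans (Set.ncard_le_ncard ?_ ((M.ground_finite.finite_subsets.subset (fun B hB => hB.1)).union
      (M.ground_finite.finite_subsets.subset (fun B hB => hB.1)))) (Set.ncard_union_le _ _)
    rintro B ⟨hBE, hB5, hB6, hBs⟩
    have hBfin : B.Finite := M.ground_finite.subset hBE
    have h5le : 5 ≤ B.ncard := by
      have := M.eRk_le_encard B
      rw [hB5, ← hBfin.cast_ncard_eq] at this
      exact_mod_cast this
    rcases (show B.ncard = 5 ∨ B.ncard = 6 by omega) with h | h
    · exact Or.inl ⟨hBE, h, hB5, hBs⟩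
    · exact Or.inr ⟨hBE, h, hB5, hBs⟩
  have hUsum : Matroid.topCount M 13 5 ≤
      {B : Set α | B ⊆ M.E ∧ B.ncard = 5 ∧ M.eRk B = 5 ∧ M.eRk (M.E \ B) = M.eRank}.ncard +
      {B : Set α | B ⊆ M.E ∧ B.ncard = 6 ∧ M.eRk B = 5 ∧ M.eRk (M.E \ B) = M.eRank}.ncard := hU1.trans hsplit
  -- the three pairwise disjoint triangles are given
  have hfinT : ∀ {T : Set α}, M.IsCircuit T → T.Finite := fun hT => M.ground_finite.subset hT.subset_ground
  have hne_of_disj : ∀ {T T' : Set α}, T.ncard = 3 → Disjoint T T' → T ≠ T' := by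
    intro T T' hT3 hdis heq
    subst heq
    have hemp : T = ∅ := by
      rw [← Set.inter_self T]
      exact Set.disjoint_iff_inter_eq_empty.1 hdis
    rw [hemp, Set.ncard_empty] at hT3
    omega
  have n12 : T₁ ≠ T₂ := hne_of_disj hT₁3 d12
  have n13 : T₁ ≠ T₃ := hne_of_disj hT₁3 d13
  have n23 : T₂ ≠ T₃ := hne_of_disj hT₂3 d23
  -- the sizes of the complements of the unions
  have hsize2 : ∀ {T T' : Set α}, M.IsCircuit T → T.ncard = 3 → M.IsCircuit T' → T'.ncard = 3 → Disjoint T T' →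
      (M.E \ (T ∪ T')).ncard = 13 := by
    intro T T' hT hT3 hT' hT'3 hdis
    have hsub : T ∪ T' ⊆ M.E := Set.union_subset hT.subset_ground hT'.subset_ground
    have h := Set.ncard_sdiff_add_ncard_of_subset hsub M.ground_finite
    have hu := Set.ncard_union_eq hdis (hfinT hT) (hfinT hT')
    omega
  have hsize3 : (M.E \ (T₁ ∪ T₂ ∪ T₃)).ncard = 10 := by
    have hsub : T₁ ∪ T₂ ∪ T₃ ⊆ M.E :=
      Set.union_subset (Set.union_subset hT₁.subset_ground hT₂.subset_ground) hT₃.subset_ground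
    have h := Set.ncard_sdiff_add_ncard_of_subset hsub M.ground_finite
    have hu12 := Set.ncard_union_eq d12 (hfinT hT₁) (hfinT hT₂)
    have hu : (T₁ ∪ T₂ ∪ T₃).ncard = (T₁ ∪ T₂).ncard + T₃.ncard :=
      Set.ncard_union_eq (Set.disjoint_union_left.2 ⟨d13, d23⟩) ((hfinT hT₁).union (hfinT hT₂)) (hfinT hT₃)
    omega
  have hsize1 : ∀ {T : Set α}, M.IsCircuit T → T.ncard = 3 → (M.E \ T).ncard = 16 := by
    intro T hT hT3
    have h := Set.ncard_sdiff_add_ncard_of_subset hT.subset_ground M.ground_finite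
    omega
  -- the top `5`-sets: every top `5`-set meets every pair of circuits, hence misses at most one of the three
  have htop5 : {B : Set α | B ⊆ M.E ∧ B.ncard = 5 ∧ M.eRk B = 5 ∧ M.eRk (M.E \ B) = M.eRank}.ncard ≤ 8271 := by
    have hhit12 := S2.top_five_inter_union_nonempty M hR hn hT₁ hT₂ n12
    have hhit13 := S2.top_five_inter_union_nonempty M hR hn hT₁ hT₃ n13
    have hhit23 := S2.top_five_inter_union_nonempty M hR hn hT₂ hT₃ n23
    have hsub : {B : Set α | B ⊆ M.E ∧ B.ncard = 5 ∧ M.eRk B = 5 ∧ M.eRk (M.E \ B) = M.eRank} ⊆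
        {X : Set α | X ⊆ M.E ∧ X.ncard = 5 ∧
          (((X ∩ T₁).Nonempty ∧ (X ∩ T₂).Nonempty) ∨ ((X ∩ T₁).Nonempty ∧ (X ∩ T₃).Nonempty) ∨
            ((X ∩ T₂).Nonempty ∧ (X ∩ T₃).Nonempty))} := by
      rintro B ⟨hBE, hB5, -, hBs⟩
      exact ⟨hBE, hB5, two_of_three_of_pair_unions (hhit12 B hBE hB5 hBs) (hhit13 B hBE hB5 hBs) (hhit23 B hBE hB5 hBs)⟩
    have hle := Set.ncard_le_ncard hsub (M.ground_finite.finite_subsets.subset (fun X hX => hX.1))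
    have hcount := S2.ncard_subsets_two_of_three_add_le M.E T₁ T₂ T₃ M.ground_finite 5
    rw [hn, hsize2 hT₁ hT₁3 hT₂ hT₂3 d12, hsize2 hT₁ hT₁3 hT₃ hT₃3 d13, hsize2 hT₂ hT₂3 hT₃ hT₃3 d23, hsize3] at hcount
    norm_num [Nat.choose] at hcount
    omega
  -- the top `6`-sets: cobases, hence meeting every circuit
  have htop6 : {B : Set α | B ⊆ M.E ∧ B.ncard = 6 ∧ M.eRk B = 5 ∧ M.eRk (M.E \ B) = M.eRank}.ncard ≤ 8046 := by
    have hmeet : ∀ B ⊆ M.E, B.ncard = 6 → M.eRk (M.E \ B) = M.eRank → ∀ {C : Set α}, M.IsCircuit C → (B ∩ C).Nonempty := by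
      intro B hBE hB6 hBs C hC
      by_contra hemp
      rw [Set.not_nonempty_iff_eq_empty, ← Set.disjoint_iff_inter_eq_empty] at hemp
      have hCsub : C ⊆ M.E \ B := Set.subset_sdiff.2 ⟨hC.subset_ground, hemp.symm⟩
      have hfinEB : (M.E \ B).Finite := M.ground_finite.subset sdiff_subset
      have hcard : (M.E \ B).ncard = 13 := by
        have h := Set.ncard_sdiff_add_ncard_of_subset hBE M.ground_finite
        omega
      have hind : M.Indep (M.E \ B) := by
        rw [Matroid.indep_iff_eRk_eq_encard_of_finite hfinEB, hBs, hR, ← hfinEB.cast_ncard_eq, hcard]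
      exact hC.dep.not_indep (hind.subset hCsub)
    have hsub : {B : Set α | B ⊆ M.E ∧ B.ncard = 6 ∧ M.eRk B = 5 ∧ M.eRk (M.E \ B) = M.eRank} ⊆
        {X : Set α | X ⊆ M.E ∧ X.ncard = 6 ∧ (X ∩ T₁).Nonempty ∧ (X ∩ T₂).Nonempty ∧ (X ∩ T₃).Nonempty} := by
      rintro B ⟨hBE, hB6, -, hBs⟩
      exact ⟨hBE, hB6, hmeet B hBE hB6 hBs hT₁, hmeet B hBE hB6 hBs hT₂, hmeet B hBE hB6 hBs hT₃⟩
    have hle := Set.ncard_le_ncard hsub (M.ground_finite.finite_subsets.subset (fun X hX => hX.1))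
    have hcount := S2.ncard_subsets_inter_nonempty_three_add_le M.E T₁ T₂ T₃ M.ground_finite 6
    rw [hn, hsize1 hT₁ hT₁3, hsize1 hT₂ hT₂3, hsize1 hT₃ hT₃3, hsize2 hT₁ hT₁3 hT₂ hT₂3 d12,
      hsize2 hT₁ hT₁3 hT₃ hT₃3 d13, hsize2 hT₂ hT₂3 hT₃ hT₃3 d23, hsize3] at hcount
    norm_num [Nat.choose] at hcount
    omega
  have hU' : Matroid.topCount M 13 5 ≤ 16317 := by omega
  -- the spanning count: the three triangles' Bonferroni
  have hS' : {X : Set α | X ⊆ M.E ∧ M.eRk X = M.eRank}.ncard ≤ 28781 := by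
    have hS := S2.ncard_spanning_add_le_of_three_triangles M hR hn (by norm_num) hC1 hT₁ hT₁3 hT₂ hT₂3 hT₃ hT₃3 n12 n13 n23
    norm_num [Finset.sum_range_succ, Nat.choose] at hS
    omega
  -- the exact triangle count `t ∈ {9, 10}` and the rank part of the tail at `t`
  obtain ⟨t, ht⟩ : ∃ t, {C : Set α | M.IsCircuit C ∧ C.ncard = 3}.ncard = t := ⟨_, rfl⟩
  have hA := ncard_eRk_le_five_le_spread M 13 6 (by norm_num) hR hn hfree hflat hflat' t 35 158 ht.le hs4 hs5
  rw [ht] at hs3 ht3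
  rcases (show t = 3 ∨ t = 4 ∨ t = 5 ∨ t = 6 ∨ t = 7 ∨ t = 8 ∨ t = 9 ∨ t = 10 by omega) with
    ht3e | ht4e | ht5e | ht6e | ht7e | ht8e | ht9e | ht10e
  · subst ht3e
    exact cellA _ 28781 129 _ hU' hS' (by norm_num) (by norm_num) (by norm_num [Nat.choose]) hA
  · subst ht4e
    exact cellA _ 28781 131 _ hU' hS' (by norm_num) (by norm_num) (by norm_num [Nat.choose]) hA
  · subst ht5e
    exact cellA _ 28781 133 _ hU' hS' (by norm_num) (by norm_num) (by norm_num [Nat.choose]) hA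
  · subst ht6e
    exact cellA _ 28781 135 _ hU' hS' (by norm_num) (by norm_num) (by norm_num [Nat.choose]) hA
  · subst ht7e
    exact cellA _ 28781 137 _ hU' hS' (by norm_num) (by norm_num) (by norm_num [Nat.choose]) hA
  · subst ht8e
    exact cellA _ 28781 139 _ hU' hS' (by norm_num) (by norm_num) (by norm_num [Nat.choose]) hA
  · subst ht9e
    exact cellA _ 28781 141 _ hU' hS' (by norm_num) (by norm_num) (by norm_num [Nat.choose]) hA
  · subst ht10e
    exact cellA _ 28781 142 _ hU' hS' (by norm_num) (by norm_num) (by norm_num [Nat.choose]) hA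

/-- **The spread case of the coloop-free cell `(13, 6)` at `≥ 9` triangles**: three pairwise disjoint triangles exist
(`S2.exists_three_pairwise_disjoint_triangles_of_nine`). -/
theorem c025_thirteen_six_cf_spread_ge_nine (M : Matroid α) [M.Finite]
    (hR : M.eRank = ((13 : ℕ) : ℕ∞)) (hn : M.E.ncard = 13 + 6)
    (hfree : ∀ e ∈ M.E, ∃ A ⊆ M.E \ {e}, e ∉ M.closure A ∧ e ∉ M.closure ((M.E \ {e}) \ A)) (hK : ∀ e, ¬ M.IsColoop e)
    (h4 : ¬ ∃ W ⊆ M.E, W.ncard ≤ 9 ∧ W.encard = M.eRk W + 4)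
    (ht9 : 9 ≤ {C : Set α | M.IsCircuit C ∧ C.ncard = 3}.ncard) : RLS M 13 5 := by
  have hs : ∀ e ∈ M.E, ∀ f ∈ M.E, e ≠ f → M.eRk {e, f} = 2 := by
    intro e he f hf hef
    have h2 : (2 : ℕ∞) ≤ M.eRk {e, f} :=
      two_le_eRk_of_two_le_ncard_of_free M hfree (pair_subset he hf) (by rw [ncard_pair hef])
    have h3 : M.eRk {e, f} ≤ 2 := by
      have := M.eRk_le_encard {e, f}
      rwa [encard_pair hef] at this
    exact le_antisymm h3 h2
  have hC1 : ∀ L ⊆ M.E, M.eRk L = 2 → L.ncard ≤ 3 :=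
    fun L hL hr => ncard_le_three_of_eRk_two M hs hfree hL hr
  have h9 : ∀ X ⊆ M.E, X.ncard ≤ 9 → X.encard ≤ M.eRk X + 3 := by
    intro X hX hX9
    by_contra hlt
    push Not at hlt
    have hk : M.eRk X + 4 ≤ X.encard := by
      have := Order.add_one_le_of_lt hlt
      rwa [add_assoc, show (3 : ℕ∞) + 1 = 4 by norm_num] at this
    obtain ⟨W', hW'X, hW'⟩ := S2.exists_subset_encard_eq_eRk_add M hX 4 hk
    exact h4 ⟨W', hW'X.trans hX, (Set.ncard_le_ncard hW'X (M.ground_finite.subset hX)).trans hX9, hW'⟩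
  obtain ⟨T₁, T₂, T₃, hT₁, hT₁3, hT₂, hT₂3, hT₃, hT₃3, d12, d13, d23⟩ :=
    S2.exists_three_pairwise_disjoint_triangles_of_nine M hC1 h9 ht9
  exact c025_thirteen_six_cf_spread_of_three_disjoint' M hR hn hfree hK h4 (by omega) hT₁ hT₁3 hT₂ hT₂3 hT₃ hT₃3 d12 d13 d23

end ThmN

end PercRepro
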